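import Literature.NumberTheory.Automorphic.UnboundedDenominatorsProofs
import Literature.Analysis.Complex.RootsOfUnityComplementUniformization
import Literature.NumberTheory.DiophantineApproximation.ArithmeticHolonomyBound
import Literature.RingTheory.PowerSeries.NthRootDenominatorType
import HarnessLib

/-!
# The unbounded denominators theorem (Calegari–Dimitrov–Tang) — Proposition 3.0.1, analytic half

`Literature/NumberTheory/Automorphic/UnboundedDenominatorsDimensionBoundProofs.lean` — PROOF-ONLY
(no definition, no named fact; D-0026). A sequel of `UnboundedDenominatorsProofs.lean`
(`CalegariDimitrovTang2025_unboundedDenominators.dim_le_of_radius_of_mean`, the arithmetic of the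
proof of CDT Proposition 3.0.1 with its three analytic inputs — holonomy bound, radius bound, mean
growth bound — as hypotheses on real parameters).

F. Calegari, V. Dimitrov, Y. Tang, *The unbounded denominators conjecture*, J. Amer. Math. Soc. 38
(2025), proof of Proposition 3.0.1 (arXiv:2109.09040, proof of Proposition 15): "We use Corollary
2.0.2 with `U := ℂ ∖ 16^{-1/N} μ_N`, `p(x) := xᴺ`, and `φ(z) := 16^{-1/N} F_N(r z)`, where
`r := 1 − A N⁻³/2` and `F_N : D(0,1) → ℂ ∖ μ_N` is the universal covering map … By Theorems 5.1.4
and 6.0.1 … `dim ≤ e · (∫ log⁺|φᴺ|) / log|φ'(0)| ≪ N³ log N`."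

Here TWO of the three analytic inputs are DISCHARGED by tree theorems, for every holomorphic
covering `F : 𝔻 → ℂ ∖ μ_N` with `F(0) = 0` (CDT §5 Def. 5.1.2; existence:
`Literature.Analysis.Complex.exists_isCoveringMap_compl_rootsOfUnity`):

* (holonomy) CDT Theorem 2.0.1 (2.2) for `p(x) = xᴺ` —
  `Literature.NumberTheory.DiophantineApproximation.dim_le_circleAverage_posLog_of_denominatorType`,
  with the denominator type supplied by
  `Literature.RingTheory.PowerSeries.exists_denominatorType_of_pow_eq_map`;
* (mean) CDT Theorem 6.0.1 —
  `Literature.Analysis.Complex.exists_circleAverage_posLog_le_of_isCoveringMap_compl_rootsOfUnity`;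

so that ONLY the radius bound `‖F′(0)‖ ≥ 16^{1/N}(1 + A/N³)` (CDT Theorem 5.1.4, the conformal radius
of `ℂ ∖ μ_N`; NOT in the tree) remains a hypothesis — on the covering `F` itself, not as a named fact.

Contents (all PROVED):
* §1 the holonomy map `φ(z) = 16^{-1/N} F(r z)` of a disc map `F`: analytic about the closed unit disc
  (`analyticOnNhd_holonomyMap`), `φ(0) = 0`, `φ′(0) = 16^{-1/N} r F′(0)`
  (`deriv_holonomyMap`, `norm_deriv_holonomyMap`), and the proximity-function comparison
  `∫_{|z|=1} log⁺|φᴺ| ≤ N ∫_{|z|=r} log⁺|F|` (`circleAverage_posLog_pow_holonomyMap_le`, CDT (3.5));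
* §2 under the radius bound: `log|φ′(0)| ≥ A/(4N³) > 0`, so `|φ′(0)| > 1` — hypothesis (iii) of
  CDT Theorem 2.0.1 (`log_norm_deriv_holonomyMap_ge`, `one_lt_norm_deriv_holonomyMap`, CDT (3.3)–(3.4));
* §3 ★ `CalegariDimitrovTang2025_unboundedDenominators.dim_le_of_radius` — **CDT Proposition 3.0.1
  modulo (radius) and modulo the algebraization**: for every `A > 0` there is `C` such that for all
  `N ≥ 2` with `A/N³ ≤ 2/9`, every holomorphic covering `F : 𝔻 → ℂ ∖ μ_N` with `F(0) = 0` and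
  `‖F′(0)‖ ≥ 16^{1/N}(1 + A/N³)`, and every family `f₁, …, f_m ∈ ℚ⟦x⟧` admissible for
  `φ = 16^{-1/N} F(r ·)` in the sense of Theorem 2.0.1 (`x ∈ t + t²ℚ⟦t⟧` with `x(t)ᴺ ∈ ℤ⟦t⟧`,
  `f_i(x(t)) ∈ ℤ⟦t⟧`, no `ℚ[xᴺ]`-relation, `f_i ∘ φ` holomorphic about the closed disc):
  `m ≤ C · N³ log N`.

What is NOT here: the radius bound (CDT Thm 5.1.4) and the algebraization step of Proposition 3.0.1
(that the modular forms of `R_N` furnish admissible families for this `φ` — noncongruence modular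
curves over `Y(2)`, trivial local monodromies), and §§4, 6.3. Nothing here proves Theorem 1.0.1.

## References
* [CalegariDimitrovTang2025] F. Calegari, V. Dimitrov, Y. Tang, The unbounded denominators
  conjecture, J. Amer. Math. Soc. 38 (2025), no. 3, 627–702; arXiv:2109.09040: Proposition 3.0.1 and
  its proof (displays (3.3)–(3.5)), Theorems 2.0.1, 5.1.4, 6.0.1.
-/

noncomputable section

open Set Metric Filter Real
open scoped Topology

namespace Literature.NumberTheory.Automorphic

open _root_.Complex Literature.Analysis.Complex Literature.NumberTheory.DiophantineApproximation

/-! ### §1 The holonomy map `φ(z) = 16^{-1/N} F(r z)` -/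

section holonomyMap

variable {F : ℂ → ℂ} {r c : ℝ}

/-- A disc map precomposed with a contraction `z ↦ r z`, `0 ≤ r < 1`, and multiplied by a constant is
holomorphic on the open disc of radius `r⁻¹ > 1`, hence analytic about the closed unit disc — this is
why CDT insert the factor `r = 1 − A N⁻³/2` ("pulling back to a holomorphic function on `D̄(0,1)`").
[cite: CalegariDimitrovTang2025, proof of Proposition 3.0.1] -/
theorem analyticOnNhd_holonomyMap (hF : DifferentiableOn ℂ F (ball (0 : ℂ) 1)) (hr0 : 0 ≤ r)
    (hr1 : r < 1) :
    AnalyticOnNhd ℂ (fun z : ℂ ↦ (c : ℂ) * F ((r : ℂ) * z)) (closedBall (0 : ℂ) 1) := by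
  -- an open neighbourhood of the closed unit disc mapped into the unit disc by `z ↦ r z`
  obtain ⟨R, hR1, hRr⟩ : ∃ R : ℝ, 1 < R ∧ r * R < 1 := by
    rcases eq_or_lt_of_le hr0 with h | h
    · exact ⟨2, by norm_num, by rw [← h]; norm_num⟩
    · refine ⟨(1 + r⁻¹) / 2, ?_, ?_⟩
      · have : 1 < r⁻¹ := (one_lt_inv₀ h).mpr hr1
        linarith
      · have hr' : r * r⁻¹ = 1 := mul_inv_cancel₀ h.ne'
        nlinarith
  have hmaps : MapsTo (fun z : ℂ ↦ (r : ℂ) * z) (ball (0 : ℂ) R) (ball (0 : ℂ) 1) := by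
    intro z hz
    rw [mem_ball, dist_zero_right] at hz ⊢
    rw [norm_mul, Complex.norm_real, Real.norm_eq_abs, abs_of_nonneg hr0]
    calc r * ‖z‖ ≤ r * R := by gcongr
      _ < 1 := hRr
  have hd : DifferentiableOn ℂ (fun z : ℂ ↦ (c : ℂ) * F ((r : ℂ) * z)) (ball (0 : ℂ) R) :=
    ((hF.comp ((differentiableOn_const _).mul differentiableOn_id) hmaps).const_mul _)
  exact (hd.analyticOnNhd isOpen_ball).mono (closedBall_subset_ball hR1)

/-- Value at the origin: `φ(0) = 16^{-1/N} F(0) = 0` when `F(0) = 0`.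
[cite: CalegariDimitrovTang2025, proof of Proposition 3.0.1] -/
theorem holonomyMap_zero (hF0 : F 0 = 0) : (fun z : ℂ ↦ (c : ℂ) * F ((r : ℂ) * z)) 0 = 0 := by
  simp [hF0]

/-- Derivative at the origin: `φ′(0) = 16^{-1/N} · r · F′(0)`.
[cite: CalegariDimitrovTang2025, proof of Proposition 3.0.1, display (3.3)] -/
theorem deriv_holonomyMap (hF : DifferentiableOn ℂ F (ball (0 : ℂ) 1)) :
    deriv (fun z : ℂ ↦ (c : ℂ) * F ((r : ℂ) * z)) 0 = (c : ℂ) * (r : ℂ) * deriv F 0 := by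
  have hF' : HasDerivAt F (deriv F 0) ((r : ℂ) * 0) := by
    rw [mul_zero]
    exact (hF.differentiableAt (ball_mem_nhds (0 : ℂ) one_pos)).hasDerivAt
  have hlin : HasDerivAt (fun z : ℂ ↦ (r : ℂ) * z) (r : ℂ) 0 := by
    simpa using (hasDerivAt_id (0 : ℂ)).const_mul (r : ℂ)
  have hcomp : HasDerivAt (fun z : ℂ ↦ F ((r : ℂ) * z)) (deriv F 0 * (r : ℂ)) 0 := hF'.comp 0 hlin
  have h := hcomp.const_mul (c : ℂ)
  rw [h.deriv]
  ring

/-- Size of the derivative at the origin: `‖φ′(0)‖ = c · r · ‖F′(0)‖` for `c, r ≥ 0`.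
[cite: CalegariDimitrovTang2025, proof of Proposition 3.0.1, display (3.3)] -/
theorem norm_deriv_holonomyMap (hF : DifferentiableOn ℂ F (ball (0 : ℂ) 1)) (hc : 0 ≤ c)
    (hr : 0 ≤ r) :
    ‖deriv (fun z : ℂ ↦ (c : ℂ) * F ((r : ℂ) * z)) 0‖ = c * r * ‖deriv F 0‖ := by
  rw [deriv_holonomyMap hF, norm_mul, norm_mul, Complex.norm_real, Complex.norm_real,
    Real.norm_eq_abs, Real.norm_eq_abs, abs_of_nonneg hc, abs_of_nonneg hr]

/-- **The proximity-function comparison (CDT display (3.5) and the line after it):**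
`∫_{|z| = 1} log⁺ |φᴺ| ≤ N · ∫_{|z| = r} log⁺ |F|` for `φ = c F(r ·)` with `0 ≤ c ≤ 1`, `0 ≤ r < 1`:
pointwise `log⁺|c F(rz)|ᴺ = N log⁺|c F(rz)| ≤ N log⁺|F(rz)|`, and the unit circle average of
`z ↦ g(r z)` is the circle average of `g` on `|z| = r`.
[cite: CalegariDimitrovTang2025, proof of Proposition 3.0.1, display (3.5)] -/
theorem circleAverage_posLog_pow_holonomyMap_le (hF : DifferentiableOn ℂ F (ball (0 : ℂ) 1))
    (hc0 : 0 ≤ c) (hc1 : c ≤ 1) (hr0 : 0 ≤ r) (hr1 : r < 1) (N : ℕ) :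
    circleAverage (fun z : ℂ ↦ log⁺ ‖((c : ℂ) * F ((r : ℂ) * z)) ^ N‖) 0 1 ≤
      N * circleAverage (fun z : ℂ ↦ log⁺ ‖F z‖) 0 r := by
  -- continuity of `F` on the circle `|z| = r` and of `z ↦ F (r z)` on the unit circle
  have hFc : ContinuousOn F (ball (0 : ℂ) 1) := hF.continuousOn
  have hsph : MapsTo (fun z : ℂ ↦ (r : ℂ) * z) (sphere (0 : ℂ) 1) (ball (0 : ℂ) 1) := by
    intro z hz
    rw [mem_sphere, dist_zero_right] at hz
    rw [mem_ball, dist_zero_right, norm_mul, Complex.norm_real, Real.norm_eq_abs, abs_of_nonneg hr0,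
      hz, mul_one]
    exact hr1
  have hcomp : ContinuousOn (fun z : ℂ ↦ F ((r : ℂ) * z)) (sphere (0 : ℂ) 1) :=
    hFc.comp (by fun_prop) hsph
  have hint₁ : CircleIntegrable (fun z : ℂ ↦ log⁺ ‖((c : ℂ) * F ((r : ℂ) * z)) ^ N‖) 0 1 := by
    refine ContinuousOn.circleIntegrable zero_le_one ?_
    exact Real.continuous_posLog.comp_continuousOn ((continuousOn_const.mul hcomp).pow N).norm
  have hint₂ : CircleIntegrable (fun z : ℂ ↦ (N : ℝ) * log⁺ ‖F ((r : ℂ) * z)‖) 0 1 := by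
    refine ContinuousOn.circleIntegrable zero_le_one ?_
    exact continuousOn_const.mul (Real.continuous_posLog.comp_continuousOn hcomp.norm)
  -- pointwise comparison on the unit circle
  have hpt : ∀ z ∈ sphere (0 : ℂ) |(1 : ℝ)|,
      log⁺ ‖((c : ℂ) * F ((r : ℂ) * z)) ^ N‖ ≤ (N : ℝ) * log⁺ ‖F ((r : ℂ) * z)‖ := by
    intro z _
    rw [norm_pow, Real.posLog_pow, norm_mul, Complex.norm_real, Real.norm_eq_abs, abs_of_nonneg hc0]
    have hle : c * ‖F ((r : ℂ) * z)‖ ≤ ‖F ((r : ℂ) * z)‖ := by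
      calc c * ‖F ((r : ℂ) * z)‖ ≤ 1 * ‖F ((r : ℂ) * z)‖ := by gcongr
        _ = ‖F ((r : ℂ) * z)‖ := one_mul _
    exact mul_le_mul_of_nonneg_left (Real.posLog_le_posLog (by positivity) hle) (Nat.cast_nonneg N)
  calc circleAverage (fun z : ℂ ↦ log⁺ ‖((c : ℂ) * F ((r : ℂ) * z)) ^ N‖) 0 1
      ≤ circleAverage (fun z : ℂ ↦ (N : ℝ) * log⁺ ‖F ((r : ℂ) * z)‖) 0 1 :=
        circleAverage_mono hint₁ hint₂ hpt
    _ = N * circleAverage (fun z : ℂ ↦ log⁺ ‖F ((r : ℂ) * z)‖) 0 1 := by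
        rw [← smul_eq_mul, ← circleAverage_fun_smul]
        rfl
    _ = N * circleAverage (fun z : ℂ ↦ log⁺ ‖F z‖) 0 r := by
        congr 1
        rw [circleAverage_eq_circleAverage_zero_one (f := fun z : ℂ ↦ log⁺ ‖F z‖) (c := 0) (R := r)]
        simp only [add_zero]

end holonomyMap

/-! ### §2 The radius bound makes `|φ′(0)| > 1` (CDT (3.3)–(3.4)) -/

/-- **CDT (3.3)–(3.4):** if `‖F′(0)‖ ≥ 16^{1/N}(1 + A/N³)` with `0 < A/N³ ≤ 2/9`, then for
`φ = 16^{-1/N} F(r ·)`, `r = 1 − A/(2N³)`: `log ‖φ′(0)‖ ≥ A/(4N³)`.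
[cite: CalegariDimitrovTang2025, proof of Proposition 3.0.1, displays (3.3)–(3.4)] -/
theorem log_norm_deriv_holonomyMap_ge {F : ℂ → ℂ} (hF : DifferentiableOn ℂ F (ball (0 : ℂ) 1))
    {A : ℝ} (hA : 0 < A) {N : ℕ} (hN : 1 ≤ N) (hAN : A / (N : ℝ) ^ 3 ≤ 2 / 9)
    (hrad : (16 : ℝ) ^ ((N : ℝ)⁻¹) * (1 + A / (N : ℝ) ^ 3) ≤ ‖deriv F 0‖) :
    A / (N : ℝ) ^ 3 / 4 ≤ Real.log ‖deriv (fun z : ℂ ↦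
      (((16 : ℝ) ^ (-(N : ℝ)⁻¹) : ℝ) : ℂ) * F (((1 - A / (2 * (N : ℝ) ^ 3) : ℝ) : ℂ) * z)) 0‖ := by
  have hNpos : (0 : ℝ) < N := by exact_mod_cast hN
  set u : ℝ := A / (N : ℝ) ^ 3 with hu
  have hu0 : 0 < u := by positivity
  have hr0 : 0 ≤ 1 - A / (2 * (N : ℝ) ^ 3) := by
    have : A / (2 * (N : ℝ) ^ 3) = u / 2 := by rw [hu]; ring
    rw [this]; linarith
  have hc0 : (0 : ℝ) ≤ (16 : ℝ) ^ (-(N : ℝ)⁻¹) := by positivity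
  rw [norm_deriv_holonomyMap hF hc0 hr0]
  -- `16^{-1/N} · r · ρ ≥ (1 + u)(1 - u/2)`
  have h16 : (16 : ℝ) ^ (-(N : ℝ)⁻¹) * (16 : ℝ) ^ ((N : ℝ)⁻¹) = 1 := by
    rw [← Real.rpow_add (by norm_num), neg_add_cancel, Real.rpow_zero]
  have hkey : (1 + u) * (1 - u / 2) ≤
      (16 : ℝ) ^ (-(N : ℝ)⁻¹) * (1 - A / (2 * (N : ℝ) ^ 3)) * ‖deriv F 0‖ := by
    have h1 : (16 : ℝ) ^ (-(N : ℝ)⁻¹) * ((16 : ℝ) ^ ((N : ℝ)⁻¹) * (1 + u)) ≤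
        (16 : ℝ) ^ (-(N : ℝ)⁻¹) * ‖deriv F 0‖ := mul_le_mul_of_nonneg_left hrad hc0
    rw [← mul_assoc, h16, one_mul] at h1
    have h2 : A / (2 * (N : ℝ) ^ 3) = u / 2 := by rw [hu]; ring
    rw [h2]
    calc (1 + u) * (1 - u / 2) = (1 - u / 2) * (1 + u) := mul_comm _ _
      _ ≤ (1 - u / 2) * ((16 : ℝ) ^ (-(N : ℝ)⁻¹) * ‖deriv F 0‖) :=
          mul_le_mul_of_nonneg_left h1 (by rw [← h2]; exact hr0)
      _ = (16 : ℝ) ^ (-(N : ℝ)⁻¹) * (1 - u / 2) * ‖deriv F 0‖ := by ring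
  have hpos : 0 < (1 + u) * (1 - u / 2) := mul_pos (by linarith) (by linarith)
  calc u / 4 ≤ Real.log (1 + u) + Real.log (1 - u / 2) :=
        CalegariDimitrovTang2025_unboundedDenominators.log_one_add_add_log_one_sub_half_ge hu0.le hAN
    _ = Real.log ((1 + u) * (1 - u / 2)) := (Real.log_mul (by linarith) (by linarith)).symm
    _ ≤ _ := Real.log_le_log hpos hkey

/-- **Hypothesis (iii) of CDT Theorem 2.0.1 for `φ`:** under the radius bound, `‖φ′(0)‖ > 1`.
[cite: CalegariDimitrovTang2025, proof of Proposition 3.0.1, display (3.4)] -/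
theorem one_lt_norm_deriv_holonomyMap {F : ℂ → ℂ} (hF : DifferentiableOn ℂ F (ball (0 : ℂ) 1))
    {A : ℝ} (hA : 0 < A) {N : ℕ} (hN : 1 ≤ N) (hAN : A / (N : ℝ) ^ 3 ≤ 2 / 9)
    (hrad : (16 : ℝ) ^ ((N : ℝ)⁻¹) * (1 + A / (N : ℝ) ^ 3) ≤ ‖deriv F 0‖) :
    1 < ‖deriv (fun z : ℂ ↦
      (((16 : ℝ) ^ (-(N : ℝ)⁻¹) : ℝ) : ℂ) * F (((1 - A / (2 * (N : ℝ) ^ 3) : ℝ) : ℂ) * z)) 0‖ := by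
  have h := log_norm_deriv_holonomyMap_ge hF hA hN hAN hrad
  have hNpos : (0 : ℝ) < N := by exact_mod_cast hN
  have hpos : 0 < A / (N : ℝ) ^ 3 / 4 := by positivity
  by_contra hle
  push Not at hle
  have : Real.log ‖deriv (fun z : ℂ ↦ (((16 : ℝ) ^ (-(N : ℝ)⁻¹) : ℝ) : ℂ) *
      F (((1 - A / (2 * (N : ℝ) ^ 3) : ℝ) : ℂ) * z)) 0‖ ≤ 0 :=
    Real.log_nonpos (norm_nonneg _) hle
  linarith

/-! ### §3 CDT Proposition 3.0.1 modulo the radius bound and the algebraization -/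

/-- ★ **CDT Proposition 3.0.1, analytic half: the dimension bound `m ≤ C N³ log N` from the radius
bound alone.** For every `A > 0` there is a constant `C` such that: for all `N ≥ 2` with
`A/N³ ≤ 2/9`, every holomorphic covering map `F` of `ℂ ∖ μ_N = {z | zᴺ ≠ 1}` by the unit disc with
`F(0) = 0` (the universal covering `F_N`, CDT Def. 5.1.2) satisfying the RADIUS BOUND
`‖F′(0)‖ ≥ 16^{1/N}(1 + A/N³)` (CDT Theorem 5.1.4 — a hypothesis here), with
`φ(z) := 16^{-1/N} F(r z)`, `r := 1 − A/(2N³)`, and every family `f₁, …, f_m ∈ ℚ⟦x⟧` which is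
admissible for `φ` in the sense of CDT Theorem 2.0.1 with `p(x) = xᴺ` — `x(t) ∈ t + t²ℚ⟦t⟧` with
`x(t)ᴺ ∈ ℤ⟦t⟧`, each `f_i(x(t)) ∈ ℤ⟦t⟧`, no nontrivial `ℚ[xᴺ]`-linear relation, and each `f_i ∘ φ`
(formal composite with the Taylor series of `φ`) the Taylor series of a function holomorphic about
the closed unit disc — one has `m ≤ C · N³ · log N`.
Proof, as printed: `|φ′(0)| = 16^{-1/N} r |F′(0)| ≥ (1 + A/N³)(1 − A/(2N³))`, so
`log|φ′(0)| ≥ A/(4N³)` ((3.3)–(3.4)); Theorem 2.0.1 (2.2) (tree: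
`dim_le_circleAverage_posLog_of_denominatorType`, denominator type from
`exists_denominatorType_of_pow_eq_map`) gives `m ≤ e ∫_{|z|=1} log⁺|φᴺ| / log|φ′(0)|`;
`∫_{|z|=1} log⁺|φᴺ| ≤ N ∫_{|z|=r} log⁺|F_N| ≤ C_{A/2} log N` by Theorem 6.0.1 (tree:
`exists_circleAverage_posLog_le_of_isCoveringMap_compl_rootsOfUnity`, (3.5)); the bookkeeping is
`CalegariDimitrovTang2025_unboundedDenominators.dim_le_of_radius_of_mean`, `C = 4 e C_{A/2} / A`.
What remains of Proposition 3.0.1: the radius bound, and the algebraization (modular forms of `R_N`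
give admissible families). Nothing here proves CDT Theorem 1.0.1.
[cite: CalegariDimitrovTang2025, Proposition 3.0.1 (proof), Theorems 2.0.1, 5.1.4, 6.0.1] -/
theorem CalegariDimitrovTang2025_unboundedDenominators.dim_le_of_radius {A : ℝ} (hA : 0 < A) :
    ∃ C : ℝ, ∀ (N : ℕ), 2 ≤ N → A / (N : ℝ) ^ 3 ≤ 2 / 9 →
      ∀ (F : ℂ → ℂ) (hFU : MapsTo F (ball (0 : ℂ) 1) {z : ℂ | z ^ N ≠ 1}),
      DifferentiableOn ℂ F (ball (0 : ℂ) 1) → IsCoveringMap hFU.restrict → F 0 = 0 →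
      (16 : ℝ) ^ ((N : ℝ)⁻¹) * (1 + A / (N : ℝ) ^ 3) ≤ ‖deriv F 0‖ →
      ∀ (φ : ℂ → ℂ), φ = (fun z : ℂ ↦ (((16 : ℝ) ^ (-(N : ℝ)⁻¹) : ℝ) : ℂ) *
          F (((1 - A / (2 * (N : ℝ) ^ 3) : ℝ) : ℂ) * z)) →
      ∀ (m : ℕ) (x : PowerSeries ℚ), PowerSeries.constantCoeff x = 0 → PowerSeries.coeff 1 x = 1 →
      (∃ G : PowerSeries ℤ, G.map (Int.castRingHom ℚ) = x ^ N) →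
      ∀ (f : Fin m → PowerSeries ℚ),
      (∀ Q : Fin m → Polynomial ℚ,
        ∑ i, Polynomial.aeval ((PowerSeries.X : PowerSeries ℚ) ^ N) (Q i) * f i = 0 → ∀ i, Q i = 0) →
      (∀ i, ∃ G : PowerSeries ℤ, G.map (Int.castRingHom ℚ) = (f i).subst x) →
      (∀ i, ∃ g : ℂ → ℂ, AnalyticOnNhd ℂ g (closedBall 0 1) ∧
        ((f i).map (algebraMap ℚ ℂ)).subst
            (PowerSeries.mk fun n ↦ iteratedDeriv n φ 0 / n.factorial)
          = PowerSeries.mk fun n ↦ iteratedDeriv n g 0 / n.factorial) →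
      (m : ℝ) ≤ C * (N : ℝ) ^ 3 * Real.log N := by
  -- the mean-growth constant of Theorem 6.0.1 at `B = A/2`
  obtain ⟨C₀, hC₀⟩ :=
    exists_circleAverage_posLog_le_of_isCoveringMap_compl_rootsOfUnity (B := A / 2) (by positivity)
  refine ⟨4 * Real.exp 1 * C₀ / A, fun N hN hAN F hFU hF hcov hF0 hrad φ hφ m x hx0 hx1 hxN f hind
    hint han ↦ ?_⟩
  have hN1 : 1 ≤ N := by omega
  have hNpos : (0 : ℝ) < N := by exact_mod_cast (show 0 < N by omega)
  have hN3 : (0 : ℝ) < (N : ℝ) ^ 3 := by positivity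
  -- the parameters `r = 1 - A/(2N³) = 1 - (A/2)/N³`, `c = 16^{-1/N}`
  set r : ℝ := 1 - A / (2 * (N : ℝ) ^ 3) with hr
  set c : ℝ := (16 : ℝ) ^ (-(N : ℝ)⁻¹) with hc
  have hu : A / (2 * (N : ℝ) ^ 3) = (A / (N : ℝ) ^ 3) / 2 := by ring
  have hr0 : 0 ≤ r := by rw [hr, hu]; linarith [div_nonneg hA.le hN3.le]
  have hr1 : r < 1 := by
    rw [hr]
    have : 0 < A / (2 * (N : ℝ) ^ 3) := by positivity
    linarith
  have hrB : r = 1 - A / 2 / (N : ℝ) ^ 3 := by rw [hr]; ring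
  have hc0 : 0 ≤ c := by positivity
  have hc1 : c ≤ 1 := by
    rw [hc]
    exact Real.rpow_le_one_of_one_le_of_nonpos (by norm_num)
      (neg_nonpos.mpr (inv_nonneg.mpr hNpos.le))
  -- (iii) of Theorem 2.0.1 for `φ`
  have hφan : AnalyticOnNhd ℂ φ (closedBall (0 : ℂ) 1) := by
    rw [hφ]; exact analyticOnNhd_holonomyMap hF hr0 hr1
  have hφ0 : φ 0 = 0 := by rw [hφ]; exact holonomyMap_zero hF0
  have hφ1 : 1 < ‖deriv φ 0‖ := by rw [hφ]; exact one_lt_norm_deriv_holonomyMap hF hA hN1 hAN hrad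
  -- the denominator type of `x` from `x(t)ᴺ ∈ ℤ⟦t⟧`
  obtain ⟨Gx, hGx⟩ := hxN
  obtain ⟨w, hw0, hw1, hxw⟩ :=
    Literature.RingTheory.PowerSeries.exists_denominatorType_of_pow_eq_map (by omega) hx0 hx1 hGx
  have hMden : N ^ 2 ≠ 0 := pow_ne_zero 2 (by omega)
  -- Theorem 2.0.1 (2.2) for `φ`, `p(x) = xᴺ`
  have hhol := dim_le_circleAverage_posLog_of_denominatorType (N := N) (Mden := N ^ 2) hMden hw0 hw1
    (by exact_mod_cast hxw) ⟨Gx, hGx⟩ hφan hφ0 hφ1 f hind hint han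
  -- the mean growth bound (Theorem 6.0.1) on `|z| = r`
  set I : ℝ := circleAverage (fun z : ℂ ↦ log⁺ ‖F z‖) 0 r with hI
  have hI0 : 0 ≤ I := circleAverage_nonneg_of_nonneg fun z _ ↦ Real.posLog_nonneg
  have hmean : I ≤ C₀ * Real.log N / N := by
    have hBN : A / 2 < (N : ℝ) ^ 3 := by
      have h1 : A ≤ 2 / 9 * (N : ℝ) ^ 3 := by rwa [div_le_iff₀ hN3] at hAN
      nlinarith
    have h := hC₀ N hN hBN F hFU hF hcov hF0
    rwa [← hrB] at h
  -- `∫ log⁺|φᴺ| ≤ N I` and `log|φ′(0)| = log(16^{-1/N} r ρ) > 0`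
  have hnum : circleAverage (fun z : ℂ ↦ log⁺ ‖φ z ^ N‖) 0 1 ≤ N * I := by
    rw [hφ]; exact circleAverage_posLog_pow_holonomyMap_le hF hc0 hc1 hr0 hr1 N
  have hden : ‖deriv φ 0‖ = (16 : ℝ) ^ (-(N : ℝ)⁻¹) * (1 - A / (2 * (N : ℝ) ^ 3)) * ‖deriv F 0‖ := by
    rw [hφ]; exact norm_deriv_holonomyMap hF hc0 hr0
  have hlogpos : 0 < Real.log ‖deriv φ 0‖ := Real.log_pos hφ1
  have hhol' : (m : ℝ) ≤ Real.exp 1 * (N * I) /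
      Real.log ((16 : ℝ) ^ (-(N : ℝ)⁻¹) * (1 - A / (2 * (N : ℝ) ^ 3)) * ‖deriv F 0‖) := by
    rw [← hden]
    calc (m : ℝ) ≤ Real.exp 1 * circleAverage (fun z : ℂ ↦ log⁺ ‖φ z ^ N‖) 0 1 /
          Real.log ‖deriv φ 0‖ := hhol
      _ ≤ Real.exp 1 * (N * I) / Real.log ‖deriv φ 0‖ := by
          gcongr
  -- the bookkeeping of displays (3.3)–(3.5)
  exact CalegariDimitrovTang2025_unboundedDenominators.dim_le_of_radius_of_mean hA hN1 hAN hrad hmean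
    hI0 hhol'

end Literature.NumberTheory.Automorphic

end
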